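import Summits.AtomisticToContinuum.BoseEinsteinCondensation.Theorems.BECCutLineWeakDisorderGroundStateRigidityEssBounded
import HarnessLib

/-!
# Crux `GroundStateRigidity` (stmt-AtomisticToContinuum-9072), line `Sketch`: nondegeneracy of the closed-form
# ground state for ESSENTIALLY bounded pair potentials, at every box

Route `BECCutLineWeakDisorder` (decl shared verbatim by 8 routes).  Lead c1 of line `Sketch`, 2026-08-16.
Supports (does not close) stmt-AtomisticToContinuum-9072; registered stub `hasUniqueGroundState_of_essBounded`.

`hasUniqueGroundState_of_bounded` (Reduction, p108220) gives `HasUniqueGroundState v N L` for measurable BOUNDED `v`,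
`N ≥ 1`, `L > 0`; `hasUniqueGroundState_iff_offNull` (EssBounded, p111320) says nondegeneracy ignores the values of `v`
on a Lebesgue-null set of radii.  Together: nondegeneracy for every measurable `v` bounded off a null set of radii
(`∃ C, ∀ᵐ r, v r ≤ C`; e.g. `v(0) = ⊤`, or `⊤` on a null set), via the truncation `v ⊓ C`.  This is the uniqueness
statement behind `groundStateRigidity_of_essBounded`, recorded by name for the routes that consume uniqueness rather
than rigidity; the open kernel of the crux (`stub_uniquenessKernel`) is thereby about ESSENTIAL unboundedness only.
-/

noncomputable section

open MeasureTheory Filter Metric Set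
open scoped ENNReal NNReal Topology

namespace Summit.AtomisticToContinuum.BoseEinsteinCondensation.Theorems.GroundStateRigidity

open Literature.MathematicalPhysics.QuantumManyBody.BoseGas

/-- **Nondegeneracy of the Dirichlet ground state for ESSENTIALLY bounded pair potentials** (registered stub
`hasUniqueGroundState_of_essBounded`): for measurable `v` with `v ≤ C` for a.e. radius, `N ≥ 1` and `L > 0`, a
nonnegative closed-form ground state exists and ground states are unique up to a constant phase — the bounded
truncation `v ⊓ C` agrees with `v` off the null set `{r | C < v r}`, nondegeneracy holds for it
(`hasUniqueGroundState_of_bounded`) and transfers (`hasUniqueGroundState_iff_offNull`).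
[cite: ReedSimonIV1978, §XIII.12 Thms XIII.44–XIII.47] -/
theorem hasUniqueGroundState_of_essBounded :
    ∀ (N : ℕ) (v : ℝ → ℝ≥0∞) (C : ℝ≥0) (L : ℝ), 1 ≤ N → Measurable v → (∀ᵐ r : ℝ, v r ≤ C) → 0 < L →
      HasUniqueGroundState v N L := by
  intro N v C L hN hv hCae hL
  -- the exceptional null set of radii and the bounded truncation
  set S : Set ℝ := {r | (C : ℝ≥0∞) < v r} with hSdef
  have hSm : MeasurableSet S := measurableSet_lt measurable_const hv
  have hS0 : volume S = 0 := by
    rw [measure_eq_zero_iff_ae_notMem]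
    filter_upwards [hCae] with r hr
    simpa [hSdef] using hr
  set v' : ℝ → ℝ≥0∞ := fun r => min (v r) C with hv'
  have hv'm : Measurable v' := hv.min measurable_const
  have hv'C : ∀ r, v' r ≤ C := fun r => min_le_right _ _
  have hvv' : ∀ r, r ∉ S → v r = v' r := fun r hr =>
    (min_eq_left (not_lt.1 (by simpa [hSdef] using hr))).symm
  exact (hasUniqueGroundState_iff_offNull hSm hS0 hvv').2
    (hasUniqueGroundState_of_bounded N v' C L hN hv'm hv'C hL)

end Summit.AtomisticToContinuum.BoseEinsteinCondensation.Theorems.GroundStateRigidity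

end
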